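/-
Copyright: the b2b-balaban T⁴-continuum CRUX team, row NE7b OWNER lineage `t4-ne7b-p1` (gen 120). Project licence.
-/
import Summits.QuantumFields.BalabanUV.T4Continuum.Spine.NE7b.SupTorusDirichletFormCoercive

/-!
# THE CONJUGATED TORUS FORM IS COERCIVE: for a weight `w` on the fine torus `(ℤ∕(n+1)s)^d` with the BOND letter
# `|w(x+ê_μ) − w x| ≤ τ ≤ 1` and the BLOCK letter `|w p − w p′| ≤ β` (`p, p′` in one torus block), and ANY diagonal `V ≥ −λ`, the form
# of `e^{w}·H·e^{−w}`, `H = (n+1)²(−Δ) + a(n+1)^{−d}·(block sums) + V` (the Hessian `At + diag(u′∘φ)` of the torus action at ANY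
# field), has the floor `min(2,a) − λ − 2d((n+1)τ)² − a(e^β − 1)` — at `τ = κ∕(n+1)`: `min(2,a) − λ − 2dκ² − a(e^β − 1)`, free of the
# field, the mesh `n` and the period `s`; the Agmon ∕ Combes–Thomas identity on the lattice torus, the engine of the sequel (131)
# `…SupTorusHessianCombesThomas` (row NE7b, node U5c; (89) TDFC `torus_form_coercive_explicit` BY NAME; [folklore])

Cell `pub-balaban`, sub-cell `t4`, spine estimate NE7b (`T4WeightBudget.RelWeightBound`; the cell's OWN estimate — NOT PRINTED in
[Bałaban 1983–89], NOT PROVED).  Crux-route work under `Spine/NE7b/` by the row OWNER (`t4-ne7b-p1` gen 120, file (130); the numbers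
(124)–(129) are left to gen 119's column) under FREEZE (0)'s crux-prover clause, on the OWNER g118's located DEAD END «mesh-UNIFORM
locality of the response — NOT reachable by weighted `ℓ²` energy with the hard block constraint (block-constant weights: boundary term
× `(n+1)²`, trace inequality leaves `(n+1)`; smooth weights: the multiplier carries `Q(u′h)`)» and g119's (117) «volume-uniform errors per
unit volume need locality, not claimed»; NOTHING of Bałaban's is named as a Lean object, valued or asserted; no `T4Continuum/Support`
leaf typed; no `def`, no notation (the operator enters through its DISPLAYED action, the weight through its two displayed letters);
zero `sorry`.  Imports (BY NAME): the OWNER's (89) `…SupTorusDirichletFormCoercive` (`torus_form_coercive_explicit`, `torus_lapForm_eq`,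
`sum_mul_blockSum_eq`, `sum_sq_eq_sum_blocks`, `sum_block_comp_siteOf_eq`; through it TDF `sum_fine_eq_sum_blocks` and the Literature
columns `B6QGQLower276` (`chart`, `B`, `blk`, `e`, `sum_B`, `card_cube`), `Beta.{Site, siteOf, windowMap}`), Mathlib's
`Real.abs_exp_sub_one_sub_id_le`, `sq_sum_le_card_mul_sum_sq`.

WHY (located).  Both recorded obstructions belong to the CONSTRAINED problem (Agmon on `ker Q′t`).  The torus action's Hessian
`H = At + diag(u′∘φ)` is coercive on ALL of `ℓ²` — (89): the `aQ′*Q′` block term is exactly the soft constraint that makes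
`min(2,a)·Σφ² ≤ ⟨φ, At φ⟩` hold with NO side condition — so Combes–Thomas can be run on the UNCONSTRAINED form with a SMOOTH weight
`w = (κ∕(n+1))·ρ`: nothing to preserve, no multiplier; the hard constraint becomes coarse-lattice ALGEBRA afterwards (the Schur
complement `Q′t H⁻¹ Q′t*`, where `B4Sect5Torus.sect5_uniform` applies by name — the sequel's sequel).  The second-order structure is
what makes the smooth weight work: the commutator of `(n+1)²(−Δ)` with `e^{w}` is NOT small in operator norm (`≍ κ(n+1)`), but in the
SYMMETRISED form `Σ_x v x·(2v x − e^{w x − w(x+ê)}v(x+ê) − e^{w x − w(x−ê)}v(x−ê)) = Σ_x (v(x+ê) − v x)² − Σ_x (e^{δ} + e^{−δ} − 2)v x v(x+ê)`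
(`δ = w x − w(x+ê)`, translation invariance of the torus sum) the first-order terms cancel and `|e^δ + e^{−δ} − 2| ≤ 2δ² ≤ 2τ²`: after
the factor `(n+1)²` the Laplacian costs `2d((n+1)τ)² = 2dκ²`; the block term costs `a(e^β − 1)` (`|e^{Δw} − 1| ≤ e^β − 1` inside a
block, Chebyshev `(Σ_z|v|)² ≤ (n+1)^dΣ_z v²`); the diagonal `V` commutes with `e^{w}`.  [B4]'s Theorem p. 573 (1.10) (decay of the
covariant η-lattice Green's functions, uniformly in η) is the PRINTED model of this mechanism — LOCATOR ONLY, nothing of it asserted.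

WHAT IS PROVED ([folklore]; fine torus `Site d N`, `[NeZero N]`, shifts `t : ι → Site d N`; for the block ∕ form statements
`N = (n+1)s`, coarse torus `Site d s`, `[NeZero s]`, `ê_μ = siteOf (e μ)`, `σ = siteOf`, `wm = windowMap`):
* §1 `abs_exp_add_exp_neg_sub_two_le` (`|e^t + e^{−t} − 2| ≤ 2t²`, `|t| ≤ 1`), `abs_exp_sub_one_le_exp_sub_one` (`|e^t − 1| ≤ e^β − 1`,
  `|t| ≤ β`).
* §2 `sum_translate`, **`conjLap_shift_eq`** (THE AGMON IDENTITY for one shift, displayed above), **`conjLap_lower`** (bond letter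
  `τ ≤ 1` ⟹ `Σ_μΣ_x (v(x+t_μ) − v x)² − 2τ²|ι|·Σ v² ≤` the conjugated Laplacian form).
* §3 **`conjBlock_lower`** (block letter `β` ⟹ `Σ_y (Σ_z v(σ(chart (wm y) z)))² − (e^β − 1)(n+1)^d·Σ v² ≤ Σ_x v x·Σ_{q∈B(blk(wm x))}
  e^{w x − w(σq)}v(σ q)`).
* §4 `torus_form_split` ∕ `torus_form_coercive_split` ((89) in split form), **`conjForm_lower`** (THE FLOOR of the conjugated form:
  `(min(2,a) − λ − 2d((n+1)τ)² − a(e^β − 1))·Σ v² ≤ Σ_x v x·[(n+1)²Σ_μ(2v x − e^{w x−w(x+ê_μ)}v(x+ê_μ) − e^{w x−w(x−ê_μ)}v(x−ê_μ))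
  + a(n+1)^{−d}Σ_{q∈B} e^{w x − w(σq)}v(σq) + V x·v x]`, `a ≥ 0`), **`weighted_form_lower`** (the same in the original variable
  `u = e^{−w}v`: `m_w·Σ_x (e^{w x}u x)² ≤ Σ_x e^{2w x}·u x·(Hu)(x)` with the DISPLAYED action
  `(Hu)(x) = (n+1)²Σ_μ(2u x − u(x+ê_μ) − u(x−ê_μ)) + a(n+1)^{−d}Σ_{q∈B n (blk n (wm x))} u(σ q) + V x·u x`).

HONEST (what this is NOT).  Finite sums on the torus; the form only (resolvent, pointwise and two-point letters are (131)); the rate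
window `2dκ² + a(e^β − 1) < min(2,a) − λ` is explicit and far from sharp; cubic periods; scalar skeleton ((A3), NC-NE7b-α UNRULED);
nothing of the covariant ∕ gauge-field propagators of [B4]–[B6]; nothing of Bałaban's.  BY-NAME EFFECT ON THE WALL: NONE.  NE7b NOT
PRINTED ∕ NOT PROVED; spine PROVED 0∕9; rung (B)+1 on a FINITE torus — NOT infinite volume, NOT the mass gap, NOT Clay.  HONEST
DEPENDENCY: continuum YM on T⁴ ⇐ BetaPertH ∧ nine spine estimates (0∕9 proved); BetaPertH ⇐ (D1) ∧ (D4) ∧ CAP+tail; G-an2-4 gates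
asym, D1 and NE2∕3∕4.
-/

set_option autoImplicit false

noncomputable section

namespace Summit.QuantumFields.BalabanUV.T4Continuum.NE7b.SupTorusConjugatedForm

open Real
open Literature.MathematicalPhysics.QuantumFieldTheory.Balaban1983to89
open B6QGQLower276 (X e blk B side chart mem_B sum_B sum_B_const card_cube)
open Beta (Site siteOf windowMap siteOf_windowMap siteOf_add)
open SupTorusDirichletForm (sum_fine_eq_sum_blocks siteOf_chart_bijective)
open SupTorusDirichletFormCoercive (torus_lapForm_eq sum_block_comp_siteOf_eq sum_sq_eq_sum_blocks sum_mul_blockSum_eq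
  torus_form_coercive_explicit)

variable {d : ℕ}

/-! ## §1. Two scalar letters of the exponential -/

/-- `|e^t + e^{−t} − 2| ≤ 2t²` for `|t| ≤ 1` (from Mathlib's `|e^x − 1 − x| ≤ x²`). [folklore] -/
theorem abs_exp_add_exp_neg_sub_two_le {t : ℝ} (ht : |t| ≤ 1) : |exp t + exp (-t) - 2| ≤ 2 * t ^ 2 := by
  have h2 := abs_exp_sub_one_sub_id_le (x := -t) (by simpa using ht)
  rw [show exp t + exp (-t) - 2 = (exp t - 1 - t) + (exp (-t) - 1 - -t) by ring]
  calc |exp t - 1 - t + (exp (-t) - 1 - -t)| ≤ |exp t - 1 - t| + |exp (-t) - 1 - -t| := abs_add_le _ _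
    _ ≤ t ^ 2 + (-t) ^ 2 := add_le_add (abs_exp_sub_one_sub_id_le ht) h2
    _ = 2 * t ^ 2 := by ring

/-- `|e^t − 1| ≤ e^β − 1` for `|t| ≤ β`. [folklore] -/
theorem abs_exp_sub_one_le_exp_sub_one {t β : ℝ} (ht : |t| ≤ β) : |exp t - 1| ≤ exp β - 1 := by
  have hβ : 0 ≤ β := (abs_nonneg t).trans ht
  rw [abs_le]
  constructor
  · -- `1 − e^β ≤ e^t − 1`: `e^{−β} ≤ e^t` and `1 − e^β ≤ e^{−β} − 1` since `2 ≤ e^β + e^{−β}`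
    have h1 : exp (-β) ≤ exp t := exp_le_exp.2 (abs_le.1 ht).1
    have h2 : 2 ≤ exp β + exp (-β) := by
      have := add_one_le_exp β
      have := add_one_le_exp (-β)
      linarith
    linarith
  · have h1 : exp t ≤ exp β := exp_le_exp.2 (abs_le.1 ht).2
    linarith

/-! ## §2. The conjugated Laplacian form: translation by a shift, and the floor -/

section Laplacian

variable {N : ℕ} [NeZero N] {ι : Type*} [Fintype ι]

/-- Translating the summation variable: `Σ_x F(x + t) = Σ_x F x` on a finite torus. [folklore] -/
theorem sum_translate (t : Site d N) (F : Site d N → ℝ) : ∑ x, F (x + t) = ∑ x, F x :=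
  Fintype.sum_equiv (Equiv.addRight t) (fun x => F (x + t)) F fun _ => rfl

/-- **THE CONJUGATED LAPLACIAN FORM, ONE SHIFT**: for a weight `w` and a field `v`,
`Σ_x v x·(2v x − e^{w x − w(x+t)}v(x+t) − e^{w x − w(x−t)}v(x−t)) = Σ_x (v(x+t) − v x)² − Σ_x (e^{δ_x} + e^{−δ_x} − 2)·v x·v(x+t)`,
`δ_x = w x − w(x+t)` (the `x − t` term is the `x + t` term read at `x − t`). [folklore] -/
theorem conjLap_shift_eq (t : Site d N) (v w : Site d N → ℝ) :
    ∑ x, v x * (2 * v x - exp (w x - w (x + t)) * v (x + t) - exp (w x - w (x - t)) * v (x - t))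
      = ∑ x, (v (x + t) - v x) ^ 2
        - ∑ x, (exp (w x - w (x + t)) + exp (-(w x - w (x + t))) - 2) * (v x * v (x + t)) := by
  have h1 : ∑ x, v x * (exp (w x - w (x - t)) * v (x - t))
      = ∑ x, v (x + t) * (exp (w (x + t) - w x) * v x) := by
    rw [← sum_translate t (fun x => v x * (exp (w x - w (x - t)) * v (x - t)))]
    exact Finset.sum_congr rfl fun x _ => by rw [add_sub_cancel_right]
  have h2 : ∑ x, v (x + t) ^ 2 = ∑ x, v x ^ 2 := sum_translate t (fun x => v x ^ 2)
  have hL : ∑ x, v x * (2 * v x - exp (w x - w (x + t)) * v (x + t) - exp (w x - w (x - t)) * v (x - t))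
      = 2 * ∑ x, v x ^ 2 - ∑ x, v x * (exp (w x - w (x + t)) * v (x + t))
        - ∑ x, v x * (exp (w x - w (x - t)) * v (x - t)) := by
    rw [Finset.mul_sum, ← Finset.sum_sub_distrib, ← Finset.sum_sub_distrib]
    exact Finset.sum_congr rfl fun x _ => by ring
  have hR : ∑ x, (v (x + t) - v x) ^ 2
        - ∑ x, (exp (w x - w (x + t)) + exp (-(w x - w (x + t))) - 2) * (v x * v (x + t))
      = ∑ x, v (x + t) ^ 2 + ∑ x, v x ^ 2 - ∑ x, v x * (exp (w x - w (x + t)) * v (x + t))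
        - ∑ x, v (x + t) * (exp (w (x + t) - w x) * v x) := by
    rw [← Finset.sum_add_distrib, ← Finset.sum_sub_distrib, ← Finset.sum_sub_distrib, ← Finset.sum_sub_distrib]
    refine Finset.sum_congr rfl fun x _ => ?_
    rw [show -(w x - w (x + t)) = w (x + t) - w x by ring]
    ring
  rw [hL, hR, h1, h2]
  ring

/-- **THE CONJUGATED LAPLACIAN FORM IS THE LAPLACIAN FORM UP TO `2τ²` PER SHIFT**: if `|w(x + t_μ) − w x| ≤ τ ≤ 1` for all `x, μ`, then
`Σ_μ Σ_x (v(x+t_μ) − v x)² − 2τ²·|ι|·Σ_x v x² ≤ Σ_x v x·Σ_μ (2v x − e^{w x − w(x+t_μ)}v(x+t_μ) − e^{w x − w(x−t_μ)}v(x−t_μ))`. [folklore] -/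
theorem conjLap_lower (t : ι → Site d N) (v w : Site d N → ℝ) {τ : ℝ} (hτ : τ ≤ 1)
    (hw : ∀ x μ, |w (x + t μ) - w x| ≤ τ) :
    ∑ μ, ∑ x, (v (x + t μ) - v x) ^ 2 - 2 * τ ^ 2 * Fintype.card ι * ∑ x, v x ^ 2
      ≤ ∑ x, v x * ∑ μ, (2 * v x - exp (w x - w (x + t μ)) * v (x + t μ) - exp (w x - w (x - t μ)) * v (x - t μ)) := by
  -- exchange the sums and treat each shift by `conjLap_shift_eq`
  have hswap : ∑ x, v x * ∑ μ, (2 * v x - exp (w x - w (x + t μ)) * v (x + t μ) - exp (w x - w (x - t μ)) * v (x - t μ))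
      = ∑ μ, (∑ x, (v (x + t μ) - v x) ^ 2
          - ∑ x, (exp (w x - w (x + t μ)) + exp (-(w x - w (x + t μ))) - 2) * (v x * v (x + t μ))) := by
    calc ∑ x, v x * ∑ μ, (2 * v x - exp (w x - w (x + t μ)) * v (x + t μ) - exp (w x - w (x - t μ)) * v (x - t μ))
        = ∑ x, ∑ μ, v x * (2 * v x - exp (w x - w (x + t μ)) * v (x + t μ) - exp (w x - w (x - t μ)) * v (x - t μ)) :=
          Finset.sum_congr rfl fun x _ => Finset.mul_sum _ _ _
      _ = ∑ μ, ∑ x, v x * (2 * v x - exp (w x - w (x + t μ)) * v (x + t μ) - exp (w x - w (x - t μ)) * v (x - t μ)) :=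
          Finset.sum_comm
      _ = _ := Finset.sum_congr rfl fun μ _ => conjLap_shift_eq (t μ) v w
  rw [hswap]
  -- per shift, the error sum is at most `2τ²·Σ_x v²`
  have herr : ∀ μ, |∑ x, (exp (w x - w (x + t μ)) + exp (-(w x - w (x + t μ))) - 2) * (v x * v (x + t μ))|
      ≤ 2 * τ ^ 2 * ∑ x, v x ^ 2 := by
    intro μ
    have hτ0 : 0 ≤ τ := (abs_nonneg _).trans (hw 0 μ)
    calc |∑ x, (exp (w x - w (x + t μ)) + exp (-(w x - w (x + t μ))) - 2) * (v x * v (x + t μ))|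
        ≤ ∑ x, |(exp (w x - w (x + t μ)) + exp (-(w x - w (x + t μ))) - 2) * (v x * v (x + t μ))| :=
          Finset.abs_sum_le_sum_abs _ _
      _ ≤ ∑ x, 2 * τ ^ 2 * ((v x ^ 2 + v (x + t μ) ^ 2) / 2) := by
          refine Finset.sum_le_sum fun x _ => ?_
          rw [abs_mul]
          have hδ : |w x - w (x + t μ)| ≤ τ := by rw [abs_sub_comm]; exact hw x μ
          have hδ1 : |w x - w (x + t μ)| ≤ 1 := hδ.trans hτ
          have hg := abs_exp_add_exp_neg_sub_two_le hδ1
          have hsq : (w x - w (x + t μ)) ^ 2 ≤ τ ^ 2 := by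
            rw [← sq_abs]; exact pow_le_pow_left₀ (abs_nonneg _) hδ 2
          have hprod : |v x * v (x + t μ)| ≤ (v x ^ 2 + v (x + t μ) ^ 2) / 2 := by
            rw [abs_mul]
            nlinarith [sq_nonneg (|v x| - |v (x + t μ)|), sq_abs (v x), sq_abs (v (x + t μ))]
          calc |exp (w x - w (x + t μ)) + exp (-(w x - w (x + t μ))) - 2| * |v x * v (x + t μ)|
              ≤ 2 * (w x - w (x + t μ)) ^ 2 * ((v x ^ 2 + v (x + t μ) ^ 2) / 2) :=
                mul_le_mul hg hprod (abs_nonneg _) (by positivity)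
            _ ≤ 2 * τ ^ 2 * ((v x ^ 2 + v (x + t μ) ^ 2) / 2) := by
                refine mul_le_mul_of_nonneg_right ?_ (by positivity)
                linarith
      _ = 2 * τ ^ 2 * ∑ x, v x ^ 2 := by
          rw [← Finset.mul_sum, ← Finset.sum_div, Finset.sum_add_distrib, sum_translate (t μ) (fun x => v x ^ 2)]
          ring
  have hsum : ∑ μ, (∑ x, (v (x + t μ) - v x) ^ 2 - 2 * τ ^ 2 * ∑ x, v x ^ 2) ≤ ∑ μ, (∑ x, (v (x + t μ) - v x) ^ 2
        - ∑ x, (exp (w x - w (x + t μ)) + exp (-(w x - w (x + t μ))) - 2) * (v x * v (x + t μ))) :=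
    Finset.sum_le_sum fun μ _ => by linarith [(abs_le.1 (herr μ)).2]
  rw [Finset.sum_sub_distrib, Finset.sum_const, Finset.card_univ, nsmul_eq_mul] at hsum
  linarith [hsum]

end Laplacian

/-! ## §3. The conjugated block form: the floor up to `e^β − 1` -/

section Block

variable (n s : ℕ) [NeZero s]

/-- **THE CONJUGATED BLOCK FORM IS THE BLOCK FORM UP TO `(e^β − 1)·(n+1)^d`**: if the weight oscillates by at most `β` on every torus
block (`|w(σ(chart (wm y) z)) − w(σ(chart (wm y) z′))| ≤ β`), then
`Σ_y (Σ_z v(σ(chart (wm y) z)))² − (e^β − 1)(n+1)^d·Σ_x v x² ≤ Σ_x v x·Σ_{q ∈ B n (blk n (wm x))} e^{w x − w(σ q)}·v(σ q)`. [folklore] -/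
theorem conjBlock_lower (v w : Site d ((n + 1) * s) → ℝ) {β : ℝ}
    (hw : ∀ (y : Site d s) (z z' : Fin d → Fin (n + 1)),
      |w (siteOf d ((n + 1) * s) (chart n (windowMap d s y) z)) - w (siteOf d ((n + 1) * s) (chart n (windowMap d s y) z'))| ≤ β) :
    ∑ y : Site d s, (∑ z : Fin d → Fin (n + 1), v (siteOf d ((n + 1) * s) (chart n (windowMap d s y) z))) ^ 2
        - (exp β - 1) * ((n : ℝ) + 1) ^ d * ∑ x, v x ^ 2
      ≤ ∑ x, v x * ∑ q ∈ B n (blk n (windowMap d ((n + 1) * s) x)),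
          exp (w x - w (siteOf d ((n + 1) * s) q)) * v (siteOf d ((n + 1) * s) q) := by
  classical
  -- read the right side blockwise
  have hR : ∑ x, v x * ∑ q ∈ B n (blk n (windowMap d ((n + 1) * s) x)),
        exp (w x - w (siteOf d ((n + 1) * s) q)) * v (siteOf d ((n + 1) * s) q)
      = ∑ y : Site d s, ∑ z : Fin d → Fin (n + 1), ∑ z' : Fin d → Fin (n + 1),
          v (siteOf d ((n + 1) * s) (chart n (windowMap d s y) z))
            * (exp (w (siteOf d ((n + 1) * s) (chart n (windowMap d s y) z))
                - w (siteOf d ((n + 1) * s) (chart n (windowMap d s y) z')))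
              * v (siteOf d ((n + 1) * s) (chart n (windowMap d s y) z'))) := by
    rw [sum_fine_eq_sum_blocks n s]
    refine Finset.sum_congr rfl fun y _ => ?_
    rw [sum_B]
    refine Finset.sum_congr rfl fun z _ => ?_
    have hp : chart n (windowMap d s y) z ∈ B n (windowMap d s y) := mem_B.2 (B6QGQLower276.blk_chart n _ z)
    rw [sum_block_comp_siteOf_eq n s (fun x' => exp (w (siteOf d ((n + 1) * s) (chart n (windowMap d s y) z)) - w x') * v x') hp,
      sum_B, Finset.mul_sum]
  rw [hR, sum_sq_eq_sum_blocks n s v, Finset.mul_sum, ← Finset.sum_sub_distrib]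
  refine Finset.sum_le_sum fun y _ => ?_
  -- one block: abbreviate `V z := v(σ(chart (wm y) z))`, `W z := w(σ(chart (wm y) z))`
  set V : (Fin d → Fin (n + 1)) → ℝ := fun z => v (siteOf d ((n + 1) * s) (chart n (windowMap d s y) z)) with hV
  set W : (Fin d → Fin (n + 1)) → ℝ := fun z => w (siteOf d ((n + 1) * s) (chart n (windowMap d s y) z)) with hW
  show (∑ z, V z) ^ 2 - (exp β - 1) * ((n : ℝ) + 1) ^ d * ∑ z, V z ^ 2 ≤ ∑ z, ∑ z', V z * (exp (W z - W z') * V z')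
  have hsplit : ∑ z, ∑ z', V z * (exp (W z - W z') * V z')
      = (∑ z, V z) ^ 2 + ∑ z, ∑ z', (exp (W z - W z') - 1) * (V z * V z') := by
    rw [sq, Finset.sum_mul_sum, ← Finset.sum_add_distrib]
    refine Finset.sum_congr rfl fun z _ => ?_
    rw [← Finset.sum_add_distrib]
    exact Finset.sum_congr rfl fun z' _ => by ring
  have herr : |∑ z, ∑ z', (exp (W z - W z') - 1) * (V z * V z')| ≤ (exp β - 1) * ((n : ℝ) + 1) ^ d * ∑ z, V z ^ 2 := by
    calc |∑ z, ∑ z', (exp (W z - W z') - 1) * (V z * V z')|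
        ≤ ∑ z, |∑ z', (exp (W z - W z') - 1) * (V z * V z')| := Finset.abs_sum_le_sum_abs _ _
      _ ≤ ∑ z, ∑ z', (exp β - 1) * (|V z| * |V z'|) := by
          refine Finset.sum_le_sum fun z _ => (Finset.abs_sum_le_sum_abs _ _).trans (Finset.sum_le_sum fun z' _ => ?_)
          rw [abs_mul, abs_mul]
          exact mul_le_mul_of_nonneg_right (abs_exp_sub_one_le_exp_sub_one (hw y z z')) (by positivity)
      _ = (exp β - 1) * (∑ z, |V z|) ^ 2 := by
          rw [sq, Finset.sum_mul_sum, Finset.mul_sum]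
          refine Finset.sum_congr rfl fun z _ => ?_
          rw [Finset.mul_sum]
      _ ≤ (exp β - 1) * (((n : ℝ) + 1) ^ d * ∑ z, V z ^ 2) := by
          have hβ : 0 ≤ exp β - 1 := by
            have h0 : 0 ≤ β := (abs_nonneg _).trans (hw y 0 0)
            linarith [one_le_exp h0]
          refine mul_le_mul_of_nonneg_left ?_ hβ
          have hCS := sq_sum_le_card_mul_sum_sq (s := (Finset.univ : Finset (Fin d → Fin (n + 1)))) (f := fun z => |V z|)
          rw [Finset.card_univ, card_cube] at hCS
          simpa only [sq_abs] using hCS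
      _ = (exp β - 1) * ((n : ℝ) + 1) ^ d * ∑ z, V z ^ 2 := by ring
  rw [hsplit]
  have := (abs_le.1 herr).1
  linarith

end Block

/-! ## §4. The conjugated torus form is coercive: Combes–Thomas at the block scale, every field, mesh and volume -/

section Form

variable (n : ℕ) (a : ℝ) (s : ℕ) [NeZero s]

/-- The torus form of `Δ^η + aQ′*Q′` SPLIT into its Laplacian part (a sum of squared torus bonds) and its block part (a sum of squared
block sums) — TDFC's `torus_lapForm_eq` + `sum_mul_blockSum_eq`. [folklore] -/
theorem torus_form_split (v : Site d ((n + 1) * s) → ℝ) :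
    ∑ x, v x *
        (((n : ℝ) + 1) ^ 2 * ∑ μ, (2 * v x - v (x + siteOf d ((n + 1) * s) (e μ)) - v (x - siteOf d ((n + 1) * s) (e μ)))
          + a / ((n : ℝ) + 1) ^ d * ∑ q ∈ B n (blk n (windowMap d ((n + 1) * s) x)), v (siteOf d ((n + 1) * s) q))
      = ((n : ℝ) + 1) ^ 2 * ∑ μ : Fin d, ∑ x, (v (x + siteOf d ((n + 1) * s) (e μ)) - v x) ^ 2
        + a / ((n : ℝ) + 1) ^ d
          * ∑ y : Site d s, (∑ z : Fin d → Fin (n + 1), v (siteOf d ((n + 1) * s) (chart n (windowMap d s y) z))) ^ 2 := by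
  rw [← torus_lapForm_eq (fun μ => siteOf d ((n + 1) * s) (e μ)) v, ← sum_mul_blockSum_eq n s v, Finset.mul_sum,
    Finset.mul_sum, ← Finset.sum_add_distrib]
  exact Finset.sum_congr rfl fun x _ => by ring

/-- TDFC's coercivity in split form: `min(2,a)·Σ v² ≤ (n+1)²·(torus bonds) + a(n+1)^{−d}·(squared block sums)`. [folklore] -/
theorem torus_form_coercive_split (v : Site d ((n + 1) * s) → ℝ) :
    min 2 a * ∑ x, v x ^ 2
      ≤ ((n : ℝ) + 1) ^ 2 * ∑ μ : Fin d, ∑ x, (v (x + siteOf d ((n + 1) * s) (e μ)) - v x) ^ 2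
        + a / ((n : ℝ) + 1) ^ d
          * ∑ y : Site d s, (∑ z : Fin d → Fin (n + 1), v (siteOf d ((n + 1) * s) (chart n (windowMap d s y) z))) ^ 2 := by
  rw [← torus_form_split n a s v]
  exact torus_form_coercive_explicit n a s v

/-- **COMBES–THOMAS AT THE BLOCK SCALE (conjugated variable).**  Let `w` be a weight on the fine torus `(ℤ∕(n+1)s)^d` with the BOND
LETTER `|w(x + ê_μ) − w x| ≤ τ ≤ 1` and the BLOCK LETTER `|w p − w p′| ≤ β` for `p, p′` in one torus block, and `V ≥ −λ` a diagonal
potential.  Then for every field `v` the CONJUGATED form of `H = (n+1)²(−Δ) + a(n+1)^{−d}·(block sums) + V` — the form of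
`e^{w} H e^{−w}` — has the floor `min(2,a) − λ − 2d((n+1)τ)² − a(e^β − 1)`:
the Laplacian commutator costs `2τ²` per direction AFTER the factor `(n+1)²` (so `2dκ²` at `τ = κ∕(n+1)`), the block commutator costs
`a(e^β − 1)`, uniformly in the field `V`, the mesh `n` and the period `s`. [folklore] -/
theorem conjForm_lower (ha : 0 ≤ a) (v w V : Site d ((n + 1) * s) → ℝ) {τ β lam : ℝ} (hτ : τ ≤ 1)
    (hwb : ∀ x μ, |w (x + siteOf d ((n + 1) * s) (e μ)) - w x| ≤ τ)
    (hwB : ∀ (y : Site d s) (z z' : Fin d → Fin (n + 1)),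
      |w (siteOf d ((n + 1) * s) (chart n (windowMap d s y) z)) - w (siteOf d ((n + 1) * s) (chart n (windowMap d s y) z'))| ≤ β)
    (hV : ∀ x, -lam ≤ V x) :
    (min 2 a - lam - 2 * d * (((n : ℝ) + 1) * τ) ^ 2 - a * (exp β - 1)) * ∑ x, v x ^ 2
      ≤ ∑ x, v x *
          (((n : ℝ) + 1) ^ 2 * ∑ μ, (2 * v x - exp (w x - w (x + siteOf d ((n + 1) * s) (e μ))) * v (x + siteOf d ((n + 1) * s) (e μ))
              - exp (w x - w (x - siteOf d ((n + 1) * s) (e μ))) * v (x - siteOf d ((n + 1) * s) (e μ)))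
            + a / ((n : ℝ) + 1) ^ d * ∑ q ∈ B n (blk n (windowMap d ((n + 1) * s) x)),
                exp (w x - w (siteOf d ((n + 1) * s) q)) * v (siteOf d ((n + 1) * s) q)
            + V x * v x) := by
  have hvol : (0 : ℝ) < ((n : ℝ) + 1) ^ d := by positivity
  -- distribute the outer sum over the three parts
  have hdist : ∑ x, v x *
        (((n : ℝ) + 1) ^ 2 * ∑ μ, (2 * v x - exp (w x - w (x + siteOf d ((n + 1) * s) (e μ))) * v (x + siteOf d ((n + 1) * s) (e μ))
            - exp (w x - w (x - siteOf d ((n + 1) * s) (e μ))) * v (x - siteOf d ((n + 1) * s) (e μ)))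
          + a / ((n : ℝ) + 1) ^ d * ∑ q ∈ B n (blk n (windowMap d ((n + 1) * s) x)),
              exp (w x - w (siteOf d ((n + 1) * s) q)) * v (siteOf d ((n + 1) * s) q)
          + V x * v x)
      = ((n : ℝ) + 1) ^ 2 * ∑ x, v x * ∑ μ, (2 * v x - exp (w x - w (x + siteOf d ((n + 1) * s) (e μ))) * v (x + siteOf d ((n + 1) * s) (e μ))
            - exp (w x - w (x - siteOf d ((n + 1) * s) (e μ))) * v (x - siteOf d ((n + 1) * s) (e μ)))
        + a / ((n : ℝ) + 1) ^ d * ∑ x, v x * ∑ q ∈ B n (blk n (windowMap d ((n + 1) * s) x)),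
            exp (w x - w (siteOf d ((n + 1) * s) q)) * v (siteOf d ((n + 1) * s) q)
        + ∑ x, V x * v x ^ 2 := by
    rw [Finset.mul_sum, Finset.mul_sum, ← Finset.sum_add_distrib, ← Finset.sum_add_distrib]
    exact Finset.sum_congr rfl fun x _ => by ring
  rw [hdist]
  have hL := conjLap_lower (fun μ => siteOf d ((n + 1) * s) (e μ)) v w hτ hwb
  rw [Fintype.card_fin] at hL
  have hB := conjBlock_lower n s v w hwB
  have hP : -lam * ∑ x, v x ^ 2 ≤ ∑ x, V x * v x ^ 2 := by
    rw [Finset.mul_sum]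
    exact Finset.sum_le_sum fun x _ => mul_le_mul_of_nonneg_right (hV x) (sq_nonneg _)
  have hC := torus_form_coercive_split n a s v
  have hS : 0 ≤ ∑ x, v x ^ 2 := Finset.sum_nonneg fun x _ => sq_nonneg _
  have hsq : 0 ≤ ((n : ℝ) + 1) ^ 2 := by positivity
  have hdiv : 0 ≤ a / ((n : ℝ) + 1) ^ d := div_nonneg ha hvol.le
  -- multiply the two lower letters by their nonnegative prefactors and add
  have h1 := mul_le_mul_of_nonneg_left hL hsq
  have h2 := mul_le_mul_of_nonneg_left hB hdiv
  have hkey : a / ((n : ℝ) + 1) ^ d * ((exp β - 1) * ((n : ℝ) + 1) ^ d * ∑ x, v x ^ 2) = a * (exp β - 1) * ∑ x, v x ^ 2 := by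
    field_simp
  rw [mul_sub, hkey] at h2
  rw [mul_sub] at h1
  nlinarith [h1, h2, hP, hC]

/-- **THE WEIGHTED FORM LETTER (original variable).**  With `v := e^{w}·u` the conjugated form of §4 is `Σ_x e^{2w x}·u x·(Hu) x`; hence
for every `u`: `m_w·Σ_x (e^{w x}u x)² ≤ Σ_x e^{2 w x}·u x·(Hu)(x)`, `m_w = min(2,a) − λ − 2d((n+1)τ)² − a(e^β − 1)`, where `(Hu)(x)` is the
displayed action `(n+1)²Σ_μ(2u x − u(x+ê_μ) − u(x−ê_μ)) + a(n+1)^{−d}Σ_{q∈B(blk(wm x))} u(σ q) + V x·u x`. [folklore] -/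
theorem weighted_form_lower (ha : 0 ≤ a) (u w V : Site d ((n + 1) * s) → ℝ) {τ β lam : ℝ} (hτ : τ ≤ 1)
    (hwb : ∀ x μ, |w (x + siteOf d ((n + 1) * s) (e μ)) - w x| ≤ τ)
    (hwB : ∀ (y : Site d s) (z z' : Fin d → Fin (n + 1)),
      |w (siteOf d ((n + 1) * s) (chart n (windowMap d s y) z)) - w (siteOf d ((n + 1) * s) (chart n (windowMap d s y) z'))| ≤ β)
    (hV : ∀ x, -lam ≤ V x) :
    (min 2 a - lam - 2 * d * (((n : ℝ) + 1) * τ) ^ 2 - a * (exp β - 1)) * ∑ x, (exp (w x) * u x) ^ 2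
      ≤ ∑ x, exp (w x) ^ 2 * (u x *
          (((n : ℝ) + 1) ^ 2 * ∑ μ, (2 * u x - u (x + siteOf d ((n + 1) * s) (e μ)) - u (x - siteOf d ((n + 1) * s) (e μ)))
            + a / ((n : ℝ) + 1) ^ d * ∑ q ∈ B n (blk n (windowMap d ((n + 1) * s) x)), u (siteOf d ((n + 1) * s) q)
            + V x * u x)) := by
  have h := conjForm_lower n a s ha (fun x => exp (w x) * u x) w V hτ hwb hwB hV
  -- the conjugated expression at `v = e^w u` IS `e^{2w} u (Hu)` termwise
  have hterm : ∀ x, (exp (w x) * u x) *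
        (((n : ℝ) + 1) ^ 2 * ∑ μ, (2 * (exp (w x) * u x)
              - exp (w x - w (x + siteOf d ((n + 1) * s) (e μ))) * (exp (w (x + siteOf d ((n + 1) * s) (e μ))) * u (x + siteOf d ((n + 1) * s) (e μ)))
              - exp (w x - w (x - siteOf d ((n + 1) * s) (e μ))) * (exp (w (x - siteOf d ((n + 1) * s) (e μ))) * u (x - siteOf d ((n + 1) * s) (e μ))))
          + a / ((n : ℝ) + 1) ^ d * ∑ q ∈ B n (blk n (windowMap d ((n + 1) * s) x)),
              exp (w x - w (siteOf d ((n + 1) * s) q)) * (exp (w (siteOf d ((n + 1) * s) q)) * u (siteOf d ((n + 1) * s) q))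
          + V x * (exp (w x) * u x))
      = exp (w x) ^ 2 * (u x *
          (((n : ℝ) + 1) ^ 2 * ∑ μ, (2 * u x - u (x + siteOf d ((n + 1) * s) (e μ)) - u (x - siteOf d ((n + 1) * s) (e μ)))
            + a / ((n : ℝ) + 1) ^ d * ∑ q ∈ B n (blk n (windowMap d ((n + 1) * s) x)), u (siteOf d ((n + 1) * s) q)
            + V x * u x)) := by
    intro x
    have hexp : ∀ y : Site d ((n + 1) * s), exp (w x - w y) * (exp (w y) * u y) = exp (w x) * u y := fun y => by
      rw [← mul_assoc, ← exp_add, sub_add_cancel]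
    simp only [hexp]
    rw [← Finset.mul_sum]
    have hlap : ∑ μ, (2 * (exp (w x) * u x) - exp (w x) * u (x + siteOf d ((n + 1) * s) (e μ))
          - exp (w x) * u (x - siteOf d ((n + 1) * s) (e μ)))
        = exp (w x) * ∑ μ, (2 * u x - u (x + siteOf d ((n + 1) * s) (e μ)) - u (x - siteOf d ((n + 1) * s) (e μ))) := by
      rw [Finset.mul_sum]
      exact Finset.sum_congr rfl fun μ _ => by ring
    rw [hlap]
    ring
  simpa only [hterm] using h

end Form

/-! ## §5. Toy -/

/-- Toy (`d = 1`, `n = 0`, `s = 1`, `a = 1`, weight `0`, potential `0`): `conjForm_lower` with all letters inhabited by `0`. -/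
example (v : Site 1 ((0 + 1) * 1) → ℝ) :
    (min 2 (1 : ℝ) - 0 - 2 * (1 : ℕ) * ((((0 : ℕ) : ℝ) + 1) * 0) ^ 2 - 1 * (exp 0 - 1)) * ∑ x, v x ^ 2
      ≤ ∑ x, v x *
          ((((0 : ℕ) : ℝ) + 1) ^ 2 * ∑ μ, (2 * v x - exp ((0 : ℝ) - 0) * v (x + siteOf 1 ((0 + 1) * 1) (e μ))
              - exp ((0 : ℝ) - 0) * v (x - siteOf 1 ((0 + 1) * 1) (e μ)))
            + 1 / (((0 : ℕ) : ℝ) + 1) ^ (1 : ℕ) * ∑ q ∈ B 0 (blk 0 (windowMap 1 ((0 + 1) * 1) x)),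
                exp ((0 : ℝ) - 0) * v (siteOf 1 ((0 + 1) * 1) q)
            + 0 * v x) :=
  conjForm_lower (d := 1) 0 1 1 zero_le_one v (fun _ => 0) (fun _ => 0) (τ := 0) (β := 0) (lam := 0) zero_le_one
    (fun _ _ => by simp) (fun _ _ _ => by simp) (fun _ => by norm_num)

end Summit.QuantumFields.BalabanUV.T4Continuum.NE7b.SupTorusConjugatedForm
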